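import Literature.IUT.LogVolume.TensorPacketOrbitVolume
import Literature.IUT.LogVolume.TensorPacketLogHolds
import HarnessLib

/-!
# Bounds on the content of a region w.r.t. `log_p(R_I^×)` from the [IUTchIV] Prop. 1.2 sandwich
# `⊗α_i·R_I ⊆ log_p(R_I^×) ⊆ ⊗h_i·(R_I)^∼` (Dupuy–Hilado §4.9–4.12; [IUTchIV] Prop. 1.2)

Sequel to `TensorPacketOrbitContent` / `TensorPacketOrbitVolume` (the hull of the (Ind2)-orbit of a bounded region
`M ⊄ {0}` of content `m` is `hull(p^m·log_p(R_I^×))`, with `log μ̄ = −m·log p + log μ̄(hull(log_p(R_I^×)))`).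
HERE the content `m` is BOUNDED on both sides for the regions that occur (unions of bare Θ-regions
`ι_i(g_i)·(R_I)^∼`), by reading the [IUTchIV] Prop. 1.2 sandwich at pure tensors:

* UPPER bound on the content (`log_norm_le_of_iota_mem_zpow_smul_logPacket`, `content_le_of_iota_mem`): if
  `ι_i(g) ∈ p^n·log_p(R_I^×)` then `‖g‖ ≤ p^{b_I − n}` — apply the decomposition `ψ` to
  `ι_i(g) = p^n·⊗h·y` (`log_p(R_I^×) ⊆ ⊗h·R_I`, `‖h_i‖ = p^{b_i}`, `y ∈ R_I ⊆ (R_I)^∼`, `‖ψ(y)_J‖ ≤ 1`; the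
  component embeddings are isometries); so a region containing `ι_i(g)` has content `m` with
  `m·log p ≤ b_I·log p − log‖g‖`;
* LOWER bound (`iota_smul_normalizedPacket_subset_zpow_smul_logPacket`, `content_ge_of_subset_iUnion`):
  [IUTchIV] Prop. 1.2 (ii) at `φ = id` (abc-iut-S6's `prop12ii_holds`) gives
  `ι_i(g)·(R_I)^∼ ⊆ p^{⌊ord(g) − d_I − a_I⌋}·log_p(R_I^×)`, so a region inside `⋃_i ι_i(g_i)·(R_I)^∼` has content
  `m ≥ ⌊λ_min − d_I − a_I⌋` (`λ_min` = the least order among the `g_i`).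

Consequence (`packetLogμ_packetHull_orbit_ge` / `_le`): for a bounded region `M` with
`ι_i(g) ∈ M ⊆ ⋃_i ι_i(g_i)·(R_I)^∼`,

  `log‖g‖ − b_I·log p + log μ̄(hull(log_p(R_I^×))) ≤ log μ̄(hull(⋃_{g∈Ind2} g·M)) ≤ −⌊λ_min − d_I − a_I⌋·log p + log μ̄(hull(log_p(R_I^×)))`

— the two-sided numeric bracket of the Θ-hull volume at a summand with the FULL (Ind2) group asked for in
`HOME/skel/FORK-REAL-MODEL.md` §4 (the upper end is the [IUTchIV] Thm. 1.10 Step (v) route; the lower end is new in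
the tree). [cite: Mochizuki2012, IUTchIV Prop. 1.2 (i)(ii) p. 10] [cite: DupuyHilado2025, §4.9, §4.12] Honest
scope: summand level; (Ind2)/hull typed per the tree's disputed-corpus typings [claim: Mochizuki2012, status:
disputed]; no side taken on [IUTchIII] Cor. 3.12; `log μ̄(hull(log_p(R_I^×)))` is left as a term (its evaluation
is [IUTchIV] Prop. 1.4 (iii) bookkeeping). PROOF-ONLY file.
-/

noncomputable section

open Set Module
open scoped Pointwise TensorProduct

namespace Literature.IUT.LogVolume

variable (p : ℕ) [Fact p.Prime]
variable {I : Type} [Fintype I] [DecidableEq I] [Nonempty I]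
variable (k : I → Type) [∀ i, NontriviallyNormedField (k i)] [∀ i, NormedAlgebra ℚ_[p] (k i)]
  [∀ i, IsUltrametricDist (k i)] [∀ i, ProperSpace (k i)]

/-! ## Upper bound on the content: pure tensors deep inside `p^n·log_p(R_I^×)` have small norm -/

/-- **If `ι_i(g) ∈ p^n·log_p(R_I^×)` then `‖g‖ ≤ p^{−n}·p^{b_I}`** (read the `J`-component of
`ψ(ι_i(g)) = ψ(p^n)·ψ(⊗h)·ψ(y)` with `y ∈ R_I`: the embeddings `k_i → L_J` are isometries, `∏‖h_i‖ = p^{b_I}`,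
`‖ψ(y)_J‖ ≤ 1`). [cite: Mochizuki2012, IUTchIV Prop. 1.2 (i) p. 10] -/
theorem norm_le_of_iota_mem_zpow_smul_logPacket {i : I} {g : k i} {n : ℤ}
    (hg : iota p k i g ∈ ((p : ℚ_[p]) ^ n) • (logPacket p k : Set (PacketAlgebra p k))) :
    ‖g‖ ≤ (p : ℝ) ^ (-n) * (p : ℝ) ^ bSum p k := by
  obtain ⟨h, hh⟩ := exists_realizesNegB p k
  rw [← ppow_smul_set_eq] at hg
  obtain ⟨w, hw, hgw⟩ := Set.mem_smul_set.mp hg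
  obtain ⟨y, hy, rfl⟩ := exists_mem_integerPacket_of_mem_logPacket p k hh hw
  have hyO : y ∈ (normalizedPacket p k : Set (PacketAlgebra p k)) := integerPacket_le_normalizedPacket p k hy
  obtain ⟨J⟩ := (inferInstance : Nonempty (DIdx p k))
  have hyJ : ‖dEquiv p k y J‖ ≤ 1 := by
    have hmem : dEquiv p k y ∈ dEquiv p k '' (normalizedPacket p k : Set (PacketAlgebra p k)) := ⟨y, hyO, rfl⟩
    rw [image_normalizedPacket_eq_coe, coe_piUnitBallStructure, mem_polydisc] at hmem
    exact hmem J
  have hprod : ‖dEquiv p k (purePacket p k h) J‖ = (p : ℝ) ^ bSum p k := by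
    rw [psi_purePacket_apply, norm_prod, ← prod_norm_of_realizesNegB p k hh]
    exact Finset.prod_congr rfl fun i _ => norm_factorEmb p k (DFac p k) (dEquiv p k) i J (h i)
  have key : ‖g‖ = (p : ℝ) ^ (-n) * (p : ℝ) ^ bSum p k * ‖dEquiv p k y J‖ := by
    have h1 := congrArg (fun x => ‖dEquiv p k x J‖) hgw
    simp only [smul_eq_mul, map_mul, Pi.mul_apply, norm_mul] at h1
    rw [norm_dEquiv_iota, norm_psi_ppow_apply, hprod] at h1
    rw [mul_assoc]
    exact h1.symm
  rw [key]
  calc (p : ℝ) ^ (-n) * (p : ℝ) ^ bSum p k * ‖dEquiv p k y J‖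
      ≤ (p : ℝ) ^ (-n) * (p : ℝ) ^ bSum p k * 1 := mul_le_mul_of_nonneg_left hyJ (by positivity)
    _ = (p : ℝ) ^ (-n) * (p : ℝ) ^ bSum p k := mul_one _

/-- Logarithmic form: `ι_i(g) ∈ p^n·log_p(R_I^×)`, `g ≠ 0` ⇒ `log‖g‖ ≤ (b_I − n)·log p`.
[cite: Mochizuki2012, IUTchIV Prop. 1.2 (i) p. 10] -/
theorem log_norm_le_of_iota_mem_zpow_smul_logPacket {i : I} {g : k i} (hg0 : g ≠ 0) {n : ℤ}
    (hg : iota p k i g ∈ ((p : ℚ_[p]) ^ n) • (logPacket p k : Set (PacketAlgebra p k))) :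
    Real.log ‖g‖ ≤ (bSum p k - n) * Real.log p := by
  have hp0 : (0 : ℝ) < p := by exact_mod_cast (Fact.out : p.Prime).pos
  have h := Real.log_le_log (norm_pos_iff.mpr hg0) (norm_le_of_iota_mem_zpow_smul_logPacket p k hg)
  rw [Real.log_mul (zpow_ne_zero _ hp0.ne') (Real.rpow_pos_of_pos hp0 _).ne', Real.log_zpow,
    Real.log_rpow hp0] at h
  push_cast at h
  linarith

/-- A pure tensor of too large norm is NOT in `p^n·log_p(R_I^×)`. [cite: Mochizuki2012, IUTchIV Prop. 1.2 (i) p. 10] -/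
theorem iota_not_mem_zpow_smul_logPacket_of_lt {i : I} {g : k i} {n : ℤ}
    (hlt : (p : ℝ) ^ (-n) * (p : ℝ) ^ bSum p k < ‖g‖) :
    iota p k i g ∉ ((p : ℚ_[p]) ^ n) • (logPacket p k : Set (PacketAlgebra p k)) :=
  fun hg => (norm_le_of_iota_mem_zpow_smul_logPacket p k hg).not_gt hlt

/-- **Content upper bound**: a region `M ⊆ p^m·log_p(R_I^×)` containing `ι_i(g)` (`g ≠ 0`) has
`m·log p ≤ b_I·log p − log‖g‖`. [cite: Mochizuki2012, IUTchIV Prop. 1.2 (i) p. 10] -/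
theorem content_le_of_iota_mem {M : Set (PacketAlgebra p k)} {m : ℤ}
    (hM : M ⊆ ((p : ℚ_[p]) ^ m) • (logPacket p k : Set (PacketAlgebra p k))) {i : I} {g : k i} (hg0 : g ≠ 0)
    (hgM : iota p k i g ∈ M) : (m : ℝ) * Real.log p ≤ bSum p k * Real.log p - Real.log ‖g‖ := by
  have := log_norm_le_of_iota_mem_zpow_smul_logPacket p k hg0 (hM hgM)
  linarith

/-! ## Lower bound on the content: [IUTchIV] Prop. 1.2 (ii) at `φ = id` -/

omit [Nonempty I] in
/-- **`ι_i(g)·(R_I)^∼ ⊆ p^{⌊λ − d_I − a_I⌋}·log_p(R_I^×)`** for `‖g‖ = p^{−λ}`, `λ = m/e_i` — [IUTchIV] Prop. 1.2 (ii),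
first inclusion, at the identity automorphism (abc-iut-S6's `prop12ii_holds`; needs `|I| ≥ 2`).
[cite: Mochizuki2012, IUTchIV Prop. 1.2 (ii) p. 10] -/
theorem iota_smul_normalizedPacket_subset_zpow_smul_logPacket (hI : 2 ≤ Fintype.card I) {i : I} {m : ℤ}
    {g : k i} (hg : ‖g‖ = (p : ℝ) ^ (-((m : ℝ) / absRamificationIdx p (k i)))) :
    iota p k i g • (normalizedPacket p k : Set (PacketAlgebra p k)) ⊆
      ((p : ℚ_[p]) ^ ⌊(m : ℝ) / absRamificationIdx p (k i) - dSum p k - aSum p k⌋) •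
        (logPacket p k : Set (PacketAlgebra p k)) := by
  obtain ⟨h, hh⟩ := exists_realizesNegB p k
  have himg : ∀ S : Set (PacketAlgebra p k), ⇑(LinearEquiv.refl ℚ_[p] (PacketAlgebra p k)) '' S = S :=
    fun S => by ext x; simp
  have hid : IsLogPacketAut p k (LinearEquiv.refl ℚ_[p] (PacketAlgebra p k)) := himg _
  have h12 := (prop12ii_holds p k hI (LinearEquiv.refl ℚ_[p] (PacketAlgebra p k)) hid i m g hg h hh).1
  rw [himg, ppow_smul_set_eq] at h12
  exact h12

/-- **Content lower bound**: if `M ⊄ p^{m+1}·log_p(R_I^×)` while `M ⊆ ⋃_i ι_i(g_i)·(R_I)^∼` with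
`‖g_i‖ = p^{−m_i/e_i}` and `i₀` a slot of largest norm (least order `λ_min`), then `⌊λ_min − d_I − a_I⌋ ≤ m`.
[cite: Mochizuki2012, IUTchIV Prop. 1.2 (ii) p. 10] -/
theorem content_ge_of_subset_iUnion (hI : 2 ≤ Fintype.card I) {M : Set (PacketAlgebra p k)} {m : ℤ}
    (hM1 : ¬ M ⊆ ((p : ℚ_[p]) ^ (m + 1)) • (logPacket p k : Set (PacketAlgebra p k)))
    (g : Π i, k i) (mexp : I → ℤ) (hg : ∀ i, ‖g i‖ = (p : ℝ) ^ (-((mexp i : ℝ) / absRamificationIdx p (k i))))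
    (i₀ : I) (hmin : ∀ i, (mexp i₀ : ℝ) / absRamificationIdx p (k i₀) ≤ (mexp i : ℝ) / absRamificationIdx p (k i))
    (hMU : M ⊆ ⋃ i, iota p k i (g i) • (normalizedPacket p k : Set (PacketAlgebra p k))) :
    ⌊(mexp i₀ : ℝ) / absRamificationIdx p (k i₀) - dSum p k - aSum p k⌋ ≤ m := by
  set n₀ : ℤ := ⌊(mexp i₀ : ℝ) / absRamificationIdx p (k i₀) - dSum p k - aSum p k⌋ with hn₀
  have hMn : M ⊆ ((p : ℚ_[p]) ^ n₀) • (logPacket p k : Set (PacketAlgebra p k)) := by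
    refine hMU.trans (Set.iUnion_subset fun i => ?_)
    refine (iota_smul_normalizedPacket_subset_zpow_smul_logPacket p k hI (hg i)).trans
      (zpow_smul_logPacket_anti p k ?_)
    exact Int.floor_le_floor (by linarith [hmin i])
  by_contra hlt
  rw [not_le] at hlt
  exact hM1 (hMn.trans (zpow_smul_logPacket_anti p k (by omega)))

/-! ## The two-sided bracket of the orbit-hull volume -/

/-- **Lower bound on the orbit-hull volume**: for a bounded region `M` containing `ι_i(g)` (`g ≠ 0`),
`log‖g‖ − b_I·log p + log μ̄(hull(log_p(R_I^×))) ≤ log μ̄(hull(⋃_{g ∈ Ind2} g·M))`.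
[cite: DupuyHilado2025, §4.9, §4.12] [cite: Mochizuki2012, IUTchIV Prop. 1.2 (i) p. 10] -/
theorem packetLogμ_packetHull_orbit_ge {M : Set (PacketAlgebra p k)} (hMb : IsPsiBounded p k M)
    {i : I} {g : k i} (hg0 : g ≠ 0) (hgM : iota p k i g ∈ M) :
    Real.log ‖g‖ - bSum p k * Real.log p +
        packetLogμ p k (packetHull p k (logPacket p k : Set (PacketAlgebra p k))) ≤
      packetLogμ p k (packetHull p k (⋃ γ : indTwo p k, γ • M)) := by
  have hM0 : ∃ x ∈ M, x ≠ 0 := ⟨_, hgM, (map_ne_zero (iota p k i)).mpr hg0⟩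
  obtain ⟨m, hm, -, -, hvol⟩ := exists_packetLogμ_packetHull_orbit_eq p k hMb hM0
  have hc := content_le_of_iota_mem p k hm hg0 hgM
  rw [hvol]
  linarith

/-- **Upper bound on the orbit-hull volume via the content** (the Step (v) route): for a bounded region `M ⊄ {0}`
inside `⋃_i ι_i(g_i)·(R_I)^∼` (`‖g_i‖ = p^{−m_i/e_i}`, `i₀` of largest norm),
`log μ̄(hull(⋃_{g ∈ Ind2} g·M)) ≤ −⌊λ_min − d_I − a_I⌋·log p + log μ̄(hull(log_p(R_I^×)))`.
[cite: Mochizuki2012, IUTchIV Prop. 1.2 (ii) p. 10, Thm 1.10 proof Step (v) p. 27–28] -/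
theorem packetLogμ_packetHull_orbit_le (hI : 2 ≤ Fintype.card I) {M : Set (PacketAlgebra p k)}
    (hMb : IsPsiBounded p k M) (hM0 : ∃ x ∈ M, x ≠ 0)
    (g : Π i, k i) (mexp : I → ℤ) (hg : ∀ i, ‖g i‖ = (p : ℝ) ^ (-((mexp i : ℝ) / absRamificationIdx p (k i))))
    (i₀ : I) (hmin : ∀ i, (mexp i₀ : ℝ) / absRamificationIdx p (k i₀) ≤ (mexp i : ℝ) / absRamificationIdx p (k i))
    (hMU : M ⊆ ⋃ i, iota p k i (g i) • (normalizedPacket p k : Set (PacketAlgebra p k))) :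
    packetLogμ p k (packetHull p k (⋃ γ : indTwo p k, γ • M)) ≤
      -(⌊(mexp i₀ : ℝ) / absRamificationIdx p (k i₀) - dSum p k - aSum p k⌋ * Real.log p) +
        packetLogμ p k (packetHull p k (logPacket p k : Set (PacketAlgebra p k))) := by
  obtain ⟨m, -, hm1, -, hvol⟩ := exists_packetLogμ_packetHull_orbit_eq p k hMb hM0
  have hc := content_ge_of_subset_iUnion p k hI hm1 g mexp hg i₀ hmin hMU
  have hlogp : 0 ≤ Real.log p := Real.log_nonneg (by exact_mod_cast (Fact.out : p.Prime).one_lt.le)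
  have hc' : (⌊(mexp i₀ : ℝ) / absRamificationIdx p (k i₀) - dSum p k - aSum p k⌋ : ℝ) ≤ m := by exact_mod_cast hc
  rw [hvol]
  nlinarith

end Literature.IUT.LogVolume

end
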